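import Literature.AnabelianGeometry.SemiGraphs.SectionDoubleReglue
import Literature.AnabelianGeometry.SemiGraphs.TieLabels
import Literature.AnabelianGeometry.SemiGraphs.CoveringOfObject

/-!
# Sheets of a section of the reglued double: dichotomy, transfer along incidences, flip at the cell
# ([SemiAnbd] §2, Def. 2.2 (i) p. 23, Cor. 2.7 (i) p. 30)

Mochizuki, *Semi-graphs of anabelioids*, Publ. RIMS **42** (2006) 221–322, §2: Def. 2.2 (i) p. 23 (a
branch of the edge `(e, Q)` of the covering attached to `A` abuts to the vertex `(v, P)` of the component
`P ⊆ S_v` under which `Q` lies), proof of Cor. 2.7 (i) p. 30 (the sheets `ℋ″`, `g·ℋ″`)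
[cite: MochizukiSemiAnbd2006, Cor. 2.7(i) p.30].

abc-iut cell, layer L3, FACT-LIST row F-1487 (`covering_subgraphComponents_doubleCosets` AS TYPED), seat
abc-iut-w4-d080 — brick (R5e, categorical half) of the «regluing invisibility» route
(`HOME/staging/w4/w4-d080-g7/F1487-MASSBALANCE-MEMO.md` §9; GAP row G-w4d080-g7-1).  PROOF-ONLY.  For a
SECTION `σ : A → (A ⊔ A)^θ` of the reglued double (`σ ≫ codiag = 𝟙`), every connected component `P` of a
cell of `A` lies in exactly one SHEET (`P ↪ A_c --σ_c--> A_c ⊔ A_c` is `P ↪ A_c --inl-->` or `--inr-->`):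

* `Anabelioids.factor_inl_or_inr`, `Anabelioids.not_factor_inl_inr` — a morphism from a connected object
  into `X ⊔ X` factors through exactly one coprojection (fibre functor; extensivity);
* `BObj.sheet_dichotomy_S/T`, `BObj.sheet_exclusive_S/T` — every component of `S_v` / `T_e` has exactly one
  sheet under `σ`;
* `BObj.sheetT_of_sheetS` — **transfer**: along a branch `b` at `v`, for a component `Q′ ⊆ T_e` under
  `P ⊆ S_v` (`A.componentOver`), if the twist `θ_b` is the identity over `Q′` then `Q′` lies in the same sheet
  as `P`; `BObj.sheetT_flip` — **flip**: at `b₀`, the component `Q` itself (twist = component swap over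
  `Q`, abc-iut-w4-d080 `BObj.doubleTwist`) lies in the OPPOSITE sheet to the component under it.

Consumer (parity walk, memo §9): along a closed walk of `𝔾_A = A.fibreData.total` crossing the half-edge
`(b₀, Q)` an odd number of times the sheet returns flipped — so no section exists when `(e(b₀), Q)` is
non-separating; with `Hom.exists_section_double_reglue` such cells are edge section labels (CORE LEMMA,
non-separating half).  Nothing here takes a side on [IUTchIII] Cor. 3.12.
-/

namespace Literature.AnabelianGeometry

open CategoryTheory CategoryTheory.Limits CategoryTheory.PreGaloisCategory

-- objects occur under several definitionally equal presentations; let unification see through them.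
set_option backward.isDefEq.respectTransparency false

universe v₁ u₁ u

/-! ### Morphisms from a connected object into `X ⊔ X` -/

namespace Anabelioids

variable {C : Type u₁} [Category.{v₁} C] [GaloisCategory C]

/-- A morphism from a connected object into `X ⊔ Y` factors through one of the two coprojections
(its fibre point comes from one summand; `factor_iff_map_mem_range`).
[cite: MochizukiGeoAn2004, Prop. 1.1.4 p.11] -/
theorem factor_inl_or_inr {P X Y : C} [PreGaloisCategory.IsConnected P] (f : P ⟶ X ⨿ Y) :
    (∃ k : P ⟶ X, k ≫ coprod.inl = f) ∨ (∃ k : P ⟶ Y, k ≫ coprod.inr = f) := by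
  haveI := finitaryExtensive_of_galoisCategory C
  let F := GaloisCategory.getFiberFunctor C
  obtain ⟨p⟩ := nonempty_fiber_of_isConnected F P
  have hc : IsColimit (F.mapCocone (BinaryCofan.mk (coprod.inl : X ⟶ X ⨿ Y) coprod.inr)) :=
    isColimitOfPreserves F (coprodIsCoprod X Y)
  obtain ⟨⟨j⟩, y, hy⟩ := Concrete.isColimit_exists_rep (pair X Y ⋙ F) hc (F.map f p)
  cases j with
  | left =>
    left
    exact (SemiGraphs.factor_iff_map_mem_range F coprod.inl f p).mpr ⟨y, hy⟩
  | right =>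
    right
    exact (SemiGraphs.factor_iff_map_mem_range F coprod.inr f p).mpr ⟨y, hy⟩

/-- A morphism from a connected object into `X ⊔ Y` does not factor through both coprojections (the
coprojections are disjoint: extensivity). [cite: MochizukiGeoAn2004, Prop. 1.1.4 p.11] -/
theorem not_factor_inl_inr {P X Y : C} [PreGaloisCategory.IsConnected P] (k₁ : P ⟶ X) (k₂ : P ⟶ Y)
    (h : k₁ ≫ coprod.inl = k₂ ≫ coprod.inr) : False := by
  haveI := finitaryExtensive_of_galoisCategory C
  have hpb := FinitaryExtensive.isPullback_initial_to_binaryCofan (coprodIsCoprod X Y)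
  obtain ⟨hI⟩ := isInitial_of_hom_to_initial initialIsInitial
    (hpb.lift k₁ k₂ h : P ⟶ ⊥_ C)
  exact PreGaloisCategory.IsConnected.notInitial hI

end Anabelioids

/-! ### Sheets of a section of a reglued double -/

namespace SemiGraphs

namespace SemiGraphOfAnabelioids

namespace BObj

variable {𝒢 : SemiGraphOfAnabelioids.{v₁, u₁, u}} (A : 𝒢.BObj)
  (θ : ∀ b : 𝒢.graph.Branch, A.double.T (𝒢.graph.edgeOf b) ≅ A.double.T (𝒢.graph.edgeOf b))

/-- **Sheet dichotomy at a vertex cell**: a connected component `P ⊆ S_v` goes under the section `σ` into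
the first or the second sheet of `S_v ⊔ S_v` (as `P ↪ S_v --inl/inr-->`).
[cite: MochizukiSemiAnbd2006, Cor. 2.7(i) p.30] -/
theorem sheet_dichotomy_S
    (hθ : ∀ b : 𝒢.graph.Branch, (θ b).hom ≫ A.codiag.fT (𝒢.graph.edgeOf b) = A.codiag.fT (𝒢.graph.edgeOf b))
    (σ : A ⟶ A.double.reglue θ) (hσ : σ ≫ BObj.Hom.reglue A.codiag θ hθ = 𝟙 A)
    (v : 𝒢.graph.Vertex) (P : π₀Obj (A.S v)) :
    P.1.arrow ≫ σ.fS v = P.1.arrow ≫ coprod.inl ∨ P.1.arrow ≫ σ.fS v = P.1.arrow ≫ coprod.inr := by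
  haveI := P.2
  have hsec : σ.fS v ≫ coprod.desc (𝟙 (A.S v)) (𝟙 (A.S v)) = 𝟙 _ :=
    congrArg (fun f => BObj.Hom.fS f v) hσ
  rcases Anabelioids.factor_inl_or_inr (P.1.arrow ≫ σ.fS v) with ⟨k, hk⟩ | ⟨k, hk⟩
  · left
    have : k = P.1.arrow := by
      have h := congrArg (· ≫ coprod.desc (𝟙 (A.S v)) (𝟙 (A.S v))) hk
      simp only [Category.assoc, coprod.inl_desc, Category.comp_id, hsec] at h
      exact h
    rw [← hk, this]
  · right
    have : k = P.1.arrow := by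
      have h := congrArg (· ≫ coprod.desc (𝟙 (A.S v)) (𝟙 (A.S v))) hk
      simp only [Category.assoc, coprod.inr_desc, Category.comp_id, hsec] at h
      exact h
    rw [← hk, this]

/-- **Sheet dichotomy at an edge cell**. [cite: MochizukiSemiAnbd2006, Cor. 2.7(i) p.30] -/
theorem sheet_dichotomy_T
    (hθ : ∀ b : 𝒢.graph.Branch, (θ b).hom ≫ A.codiag.fT (𝒢.graph.edgeOf b) = A.codiag.fT (𝒢.graph.edgeOf b))
    (σ : A ⟶ A.double.reglue θ) (hσ : σ ≫ BObj.Hom.reglue A.codiag θ hθ = 𝟙 A)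
    (e : 𝒢.graph.Edge) (Q : π₀Obj (A.T e)) :
    Q.1.arrow ≫ σ.fT e = Q.1.arrow ≫ coprod.inl ∨ Q.1.arrow ≫ σ.fT e = Q.1.arrow ≫ coprod.inr := by
  haveI := Q.2
  have hsec : σ.fT e ≫ coprod.desc (𝟙 (A.T e)) (𝟙 (A.T e)) = 𝟙 _ :=
    congrArg (fun f => BObj.Hom.fT f e) hσ
  rcases Anabelioids.factor_inl_or_inr (Q.1.arrow ≫ σ.fT e) with ⟨k, hk⟩ | ⟨k, hk⟩
  · left
    have : k = Q.1.arrow := by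
      have h := congrArg (· ≫ coprod.desc (𝟙 (A.T e)) (𝟙 (A.T e))) hk
      simp only [Category.assoc, coprod.inl_desc, Category.comp_id, hsec] at h
      exact h
    rw [← hk, this]
  · right
    have : k = Q.1.arrow := by
      have h := congrArg (· ≫ coprod.desc (𝟙 (A.T e)) (𝟙 (A.T e))) hk
      simp only [Category.assoc, coprod.inr_desc, Category.comp_id, hsec] at h
      exact h
    rw [← hk, this]

/-- **Sheets are exclusive** (vertex cells). [cite: MochizukiSemiAnbd2006, Cor. 2.7(i) p.30] -/
theorem sheet_exclusive_S (σ : A ⟶ A.double.reglue θ) (v : 𝒢.graph.Vertex) (P : π₀Obj (A.S v))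
    (h₁ : P.1.arrow ≫ σ.fS v = P.1.arrow ≫ coprod.inl) (h₂ : P.1.arrow ≫ σ.fS v = P.1.arrow ≫ coprod.inr) :
    False := by
  haveI := P.2
  exact Anabelioids.not_factor_inl_inr P.1.arrow P.1.arrow (h₁.symm.trans h₂)

/-- **Sheets are exclusive** (edge cells). [cite: MochizukiSemiAnbd2006, Cor. 2.7(i) p.30] -/
theorem sheet_exclusive_T (σ : A ⟶ A.double.reglue θ) (e : 𝒢.graph.Edge) (Q : π₀Obj (A.T e))
    (h₁ : Q.1.arrow ≫ σ.fT e = Q.1.arrow ≫ coprod.inl) (h₂ : Q.1.arrow ≫ σ.fT e = Q.1.arrow ≫ coprod.inr) :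
    False := by
  haveI := Q.2
  exact Anabelioids.not_factor_inl_inr Q.1.arrow Q.1.arrow (h₁.symm.trans h₂)

/-- The edge component under the section, through the gluing: for a branch `b` at `v` and a component
`Q′ ⊆ T_e` lying under `P ⊆ S_v`, `Q′ ≫ σ_e = (Q′ ≫ ι) ≫ θ_b` where `ι` is the sheet of `P`
transported (`inl ↦ inl`, `inr ↦ inr`).  [cite: MochizukiSemiAnbd2006, Def. 2.2(i) p.23] -/
theorem arrow_comp_sheetT_eq (σ : A ⟶ A.double.reglue θ)
    (b : 𝒢.graph.Branch) (v : 𝒢.graph.Vertex) (h : 𝒢.graph.abuts b = some v)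
    (Q' : π₀Obj (A.T (𝒢.graph.edgeOf b))) (P : π₀Obj (A.S v))
    (hle : Q'.1 ≤ A.branchImage b v h P.1)
    (ι : A.S v ⟶ A.S v ⨿ A.S v) (ιT : A.T (𝒢.graph.edgeOf b) ⟶ A.T _ ⨿ A.T _)
    (hι : (𝒢.pull b v h).pullback.map ι ≫ (A.double.ψ b v h).hom = (A.ψ b v h).hom ≫ ιT)
    (hP : P.1.arrow ≫ σ.fS v = P.1.arrow ≫ ι) :
    Q'.1.arrow ≫ σ.fT (𝒢.graph.edgeOf b) = (Q'.1.arrow ≫ ιT) ≫ (θ b).hom := by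
  have hcomm := σ.comm b v h
  rw [BObj.reglue_ψ_hom] at hcomm
  -- `Q′ ↪ b^*P ↪ b^*S_v ⥲ T_e` is the inclusion of `Q′`
  have hinc := A.inclOfLE_comp h P.1 Q'.1 hle
  have e1 : Q'.1.arrow ≫ σ.fT (𝒢.graph.edgeOf b) =
      A.inclOfLE h P.1 Q'.1 hle ≫ (𝒢.pull b v h).pullback.map P.1.arrow ≫
        ((𝒢.pull b v h).pullback.map (σ.fS v) ≫ (A.double.ψ b v h).hom ≫ (θ b).hom) :=
    calc Q'.1.arrow ≫ σ.fT (𝒢.graph.edgeOf b)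
        = (A.inclOfLE h P.1 Q'.1 hle ≫ (𝒢.pull b v h).pullback.map P.1.arrow ≫ (A.ψ b v h).hom) ≫
            σ.fT (𝒢.graph.edgeOf b) := by rw [hinc]
      _ = A.inclOfLE h P.1 Q'.1 hle ≫ (𝒢.pull b v h).pullback.map P.1.arrow ≫
            ((A.ψ b v h).hom ≫ σ.fT (𝒢.graph.edgeOf b)) := by simp only [Category.assoc]
      _ = _ := by rw [hcomm]
  have e2 : (𝒢.pull b v h).pullback.map P.1.arrow ≫ (𝒢.pull b v h).pullback.map (σ.fS v) ≫
        (A.double.ψ b v h).hom ≫ (θ b).hom =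
      (𝒢.pull b v h).pullback.map P.1.arrow ≫ ((A.ψ b v h).hom ≫ ιT) ≫ (θ b).hom :=
    calc (𝒢.pull b v h).pullback.map P.1.arrow ≫ (𝒢.pull b v h).pullback.map (σ.fS v) ≫
          (A.double.ψ b v h).hom ≫ (θ b).hom
        = (𝒢.pull b v h).pullback.map (P.1.arrow ≫ σ.fS v) ≫ (A.double.ψ b v h).hom ≫ (θ b).hom := by
          rw [Functor.map_comp_assoc]
      _ = (𝒢.pull b v h).pullback.map (P.1.arrow ≫ ι) ≫ (A.double.ψ b v h).hom ≫ (θ b).hom := by rw [hP]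
      _ = (𝒢.pull b v h).pullback.map P.1.arrow ≫ ((𝒢.pull b v h).pullback.map ι ≫
            (A.double.ψ b v h).hom) ≫ (θ b).hom := by
          rw [Functor.map_comp_assoc, Category.assoc]
      _ = _ := by rw [hι]
  rw [e1, e2, ← hinc]
  simp only [Category.assoc]

/-- A morphism into `T_e ⊔ T_e` lying over the component `Q′` factors through the piece of `T_e ⊔ T_e` over
`Q′`; so a twist which is the identity on that piece fixes it. [cite: MochizukiSemiAnbd2006, Cor. 2.7(i) p.30] -/
theorem comp_eq_of_fst_comp_eq (e : 𝒢.graph.Edge) (Q' : π₀Obj (A.T e)) {τ : A.T e ⨿ A.T e ⟶ A.T e ⨿ A.T e}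
    (hτ : pullback.fst (A.codiag.fT e) Q'.1.arrow ≫ τ = pullback.fst (A.codiag.fT e) Q'.1.arrow)
    (x : (Q'.1 : 𝒢.E e) ⟶ A.T e ⨿ A.T e) (hx : x ≫ A.codiag.fT e = Q'.1.arrow) : x ≫ τ = x := by
  have hl : pullback.lift x (𝟙 _) (by rw [hx, Category.id_comp]) ≫
      pullback.fst (A.codiag.fT e) Q'.1.arrow = x := pullback.lift_fst _ _ _
  rw [← hl, Category.assoc, hτ]

/-- **Transfer of sheets along an incidence where the twist is trivial.**  For a branch `b` at `v`, a
component `Q′ ⊆ T_e` under `P ⊆ S_v`, and a twist `θ_b` which is the identity on the piece over `Q′`: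
`Q′` lies in the first sheet iff `P` does (and likewise for the second).
[cite: MochizukiSemiAnbd2006, Cor. 2.7(i) p.30] -/
theorem sheetT_of_sheetS (σ : A ⟶ A.double.reglue θ)
    (b : 𝒢.graph.Branch) (v : 𝒢.graph.Vertex) (h : 𝒢.graph.abuts b = some v)
    (Q' : π₀Obj (A.T (𝒢.graph.edgeOf b))) (P : π₀Obj (A.S v)) (hle : Q'.1 ≤ A.branchImage b v h P.1)
    (htriv : pullback.fst (A.codiag.fT (𝒢.graph.edgeOf b)) Q'.1.arrow ≫ (θ b).hom =
      pullback.fst (A.codiag.fT (𝒢.graph.edgeOf b)) Q'.1.arrow) :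
    (P.1.arrow ≫ σ.fS v = P.1.arrow ≫ coprod.inl →
        Q'.1.arrow ≫ σ.fT (𝒢.graph.edgeOf b) = Q'.1.arrow ≫ coprod.inl) ∧
      (P.1.arrow ≫ σ.fS v = P.1.arrow ≫ coprod.inr →
        Q'.1.arrow ≫ σ.fT (𝒢.graph.edgeOf b) = Q'.1.arrow ≫ coprod.inr) := by
  refine ⟨fun hP => ?_, fun hP => ?_⟩
  · rw [A.arrow_comp_sheetT_eq θ σ b v h Q' P hle coprod.inl coprod.inl
      (A.map_inl_comp_double_ψ_hom b v h) hP]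
    exact A.comp_eq_of_fst_comp_eq _ Q' htriv _ (by
      change (Q'.1.arrow ≫ coprod.inl) ≫ coprod.desc (𝟙 _) (𝟙 _) = _
      rw [Category.assoc, coprod.inl_desc, Category.comp_id])
  · rw [A.arrow_comp_sheetT_eq θ σ b v h Q' P hle coprod.inr coprod.inr
      (A.map_inr_comp_double_ψ_hom b v h) hP]
    exact A.comp_eq_of_fst_comp_eq _ Q' htriv _ (by
      change (Q'.1.arrow ≫ coprod.inr) ≫ coprod.desc (𝟙 _) (𝟙 _) = _
      rw [Category.assoc, coprod.inr_desc, Category.comp_id])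

end BObj

/-! ### The flip at the reglued cell -/

namespace BObj

variable {𝒢 : SemiGraphOfAnabelioids.{v₁, u₁, u}} (A : 𝒢.BObj) (b₀ : 𝒢.graph.Branch)
  (Q : {P : Subobject (A.T (𝒢.graph.edgeOf b₀)) //
    PreGaloisCategory.IsConnected (P : 𝒢.E (𝒢.graph.edgeOf b₀))})

/-- On the piece over `Q` the component swap IS the swap of the two sheets.
[cite: MochizukiSemiAnbd2006, Cor. 2.7(i) p.30] -/
theorem fst_comp_componentSwap_self {C : Type u₁} [Category.{v₁} C] [GaloisCategory C] (X : C)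
    (Q : {P : Subobject X // PreGaloisCategory.IsConnected (P : C)}) :
    pullback.fst (coprod.desc (𝟙 X) (𝟙 X)) Q.1.arrow ≫ (Anabelioids.componentSwap X Q).hom =
      pullback.fst (coprod.desc (𝟙 X) (𝟙 X)) Q.1.arrow ≫ (coprod.braiding X X).hom := by
  classical
  haveI := Anabelioids.finite_connectedSubobject X
  have h := Anabelioids.pullback_fst_isoOfPieces_hom_left
    (Equiv.refl {P : Subobject X // PreGaloisCategory.IsConnected (P : C)})
    (Y := Anabelioids.doubleOver X) (Y' := Anabelioids.doubleOver X)
    (fun P => if P = Q then (Over.pullback P.1.arrow).mapIso (Anabelioids.swapOver X) else Iso.refl _) Q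
  rw [if_pos rfl] at h
  refine h.trans ?_
  exact Anabelioids.Over.pullback_map_left_fst
    (Equiv.refl {P : Subobject X // PreGaloisCategory.IsConnected (P : C)}) _ Q

/-- The twists `doubleTwist b₀ Q` are trivial on the piece over any component `Q′ ≠ Q` at `b₀`, and at
every other branch. [cite: MochizukiSemiAnbd2006, Cor. 2.7(i) p.30] -/
theorem fst_comp_doubleTwist_of_ne (b : 𝒢.graph.Branch) (Q' : π₀Obj (A.T (𝒢.graph.edgeOf b)))
    (hne : ∀ _ : b = b₀, ¬ HEq Q' Q) :
    pullback.fst (A.codiag.fT (𝒢.graph.edgeOf b)) Q'.1.arrow ≫ (A.doubleTwist b₀ Q b).hom =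
      pullback.fst (A.codiag.fT (𝒢.graph.edgeOf b)) Q'.1.arrow := by
  by_cases hb : b = b₀
  · have hQ := hne hb
    subst hb
    rw [A.doubleTwist_self]
    exact Anabelioids.fst_comp_componentSwap_of_ne _ Q Q' (fun h => hQ (heq_of_eq h))
  · rw [A.doubleTwist_of_ne b₀ Q hb]
    exact Category.comp_id _

/-- **Transfer** for the detection twists: along every incidence `(b, Q′)` other than `(b₀, Q)`, the
component `Q′ ⊆ T_{e(b)}` lies in the same sheet as the component `P ⊆ S_v` under which it lies.
[cite: MochizukiSemiAnbd2006, Cor. 2.7(i) p.30] -/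
theorem sheet_transfer (σ : A ⟶ A.double.reglue (A.doubleTwist b₀ Q))
    (hσ : σ ≫ BObj.Hom.reglue A.codiag (A.doubleTwist b₀ Q) (A.doubleTwist_codiag b₀ Q) = 𝟙 A)
    (b : 𝒢.graph.Branch) (v : 𝒢.graph.Vertex) (h : 𝒢.graph.abuts b = some v)
    (Q' : π₀Obj (A.T (𝒢.graph.edgeOf b))) (P : π₀Obj (A.S v)) (hle : Q'.1 ≤ A.branchImage b v h P.1)
    (hne : ∀ _ : b = b₀, ¬ HEq Q' Q) :
    (P.1.arrow ≫ σ.fS v = P.1.arrow ≫ coprod.inl ↔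
        Q'.1.arrow ≫ σ.fT (𝒢.graph.edgeOf b) = Q'.1.arrow ≫ coprod.inl) := by
  have ht := A.sheetT_of_sheetS (A.doubleTwist b₀ Q) σ b v h Q' P hle
    (A.fst_comp_doubleTwist_of_ne b₀ Q b Q' hne)
  refine ⟨ht.1, fun hQ' => ?_⟩
  rcases A.sheet_dichotomy_S (A.doubleTwist b₀ Q) (A.doubleTwist_codiag b₀ Q) σ hσ v P with hP | hP
  · exact hP
  · exact (A.sheet_exclusive_T (A.doubleTwist b₀ Q) σ _ Q' hQ' (ht.2 hP)).elim

/-- **Flip at the reglued cell**: at `b₀` (abutting to `v₀`), the component `Q` itself lies in the OPPOSITE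
sheet to the component `P ⊆ S_{v₀}` under which it lies. [cite: MochizukiSemiAnbd2006, Cor. 2.7(i) p.30] -/
theorem sheet_flip (σ : A ⟶ A.double.reglue (A.doubleTwist b₀ Q))
    (hσ : σ ≫ BObj.Hom.reglue A.codiag (A.doubleTwist b₀ Q) (A.doubleTwist_codiag b₀ Q) = 𝟙 A)
    (v₀ : 𝒢.graph.Vertex) (h₀ : 𝒢.graph.abuts b₀ = some v₀) (P : π₀Obj (A.S v₀))
    (hle : Q.1 ≤ A.branchImage b₀ v₀ h₀ P.1) :
    (P.1.arrow ≫ σ.fS v₀ = P.1.arrow ≫ coprod.inl ↔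
        Q.1.arrow ≫ σ.fT (𝒢.graph.edgeOf b₀) = Q.1.arrow ≫ coprod.inr) := by
  -- the section through `Q` is the sheet of `P` followed by the component swap, i.e. the braiding
  have key : ∀ (ι : A.S v₀ ⟶ A.S v₀ ⨿ A.S v₀) (ιT : A.T (𝒢.graph.edgeOf b₀) ⟶ A.T _ ⨿ A.T _)
      (_ : (𝒢.pull b₀ v₀ h₀).pullback.map ι ≫ (A.double.ψ b₀ v₀ h₀).hom = (A.ψ b₀ v₀ h₀).hom ≫ ιT)
      (_ : ιT ≫ A.codiag.fT (𝒢.graph.edgeOf b₀) = 𝟙 _),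
      P.1.arrow ≫ σ.fS v₀ = P.1.arrow ≫ ι →
        Q.1.arrow ≫ σ.fT (𝒢.graph.edgeOf b₀) =
          (Q.1.arrow ≫ ιT) ≫ (coprod.braiding (A.T (𝒢.graph.edgeOf b₀)) (A.T (𝒢.graph.edgeOf b₀))).hom := by
    intro ι ιT hι hιT hP
    rw [A.arrow_comp_sheetT_eq (A.doubleTwist b₀ Q) σ b₀ v₀ h₀ Q P hle ι ιT hι hP,
      A.doubleTwist_self]
    have hl : pullback.lift (Q.1.arrow ≫ ιT) (𝟙 _)
          (by rw [Category.assoc, hιT, Category.comp_id, Category.id_comp]) ≫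
        pullback.fst (A.codiag.fT (𝒢.graph.edgeOf b₀)) Q.1.arrow = Q.1.arrow ≫ ιT := pullback.lift_fst _ _ _
    calc (Q.1.arrow ≫ ιT) ≫ (Anabelioids.componentSwap (A.T (𝒢.graph.edgeOf b₀)) Q).hom
        = (pullback.lift (Q.1.arrow ≫ ιT) (𝟙 _)
            (by rw [Category.assoc, hιT, Category.comp_id, Category.id_comp]) ≫
            pullback.fst (A.codiag.fT (𝒢.graph.edgeOf b₀)) Q.1.arrow) ≫
            (Anabelioids.componentSwap (A.T (𝒢.graph.edgeOf b₀)) Q).hom := by rw [hl]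
      _ = pullback.lift (Q.1.arrow ≫ ιT) (𝟙 _)
            (by rw [Category.assoc, hιT, Category.comp_id, Category.id_comp]) ≫
            (pullback.fst (A.codiag.fT (𝒢.graph.edgeOf b₀)) Q.1.arrow ≫
              (Anabelioids.componentSwap (A.T (𝒢.graph.edgeOf b₀)) Q).hom) := Category.assoc _ _ _
      _ = pullback.lift (Q.1.arrow ≫ ιT) (𝟙 _)
            (by rw [Category.assoc, hιT, Category.comp_id, Category.id_comp]) ≫
            (pullback.fst (A.codiag.fT (𝒢.graph.edgeOf b₀)) Q.1.arrow ≫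
              (coprod.braiding (A.T (𝒢.graph.edgeOf b₀)) (A.T (𝒢.graph.edgeOf b₀))).hom) :=
          congrArg _ (fst_comp_componentSwap_self (A.T (𝒢.graph.edgeOf b₀)) Q)
      _ = (pullback.lift (Q.1.arrow ≫ ιT) (𝟙 _)
            (by rw [Category.assoc, hιT, Category.comp_id, Category.id_comp]) ≫
            pullback.fst (A.codiag.fT (𝒢.graph.edgeOf b₀)) Q.1.arrow) ≫
            (coprod.braiding (A.T (𝒢.graph.edgeOf b₀)) (A.T (𝒢.graph.edgeOf b₀))).hom :=
          (Category.assoc _ _ _).symm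
      _ = (Q.1.arrow ≫ ιT) ≫ (coprod.braiding (A.T (𝒢.graph.edgeOf b₀)) (A.T (𝒢.graph.edgeOf b₀))).hom := by
          rw [hl]
  have hinlT : (coprod.inl : A.T (𝒢.graph.edgeOf b₀) ⟶ _) ≫ A.codiag.fT (𝒢.graph.edgeOf b₀) = 𝟙 _ :=
    coprod.inl_desc _ _
  have hinrT : (coprod.inr : A.T (𝒢.graph.edgeOf b₀) ⟶ _) ≫ A.codiag.fT (𝒢.graph.edgeOf b₀) = 𝟙 _ :=
    coprod.inr_desc _ _
  constructor
  · intro hP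
    rw [key coprod.inl coprod.inl (A.map_inl_comp_double_ψ_hom b₀ v₀ h₀) hinlT hP, Category.assoc,
      coprod.braiding_hom, coprod.inl_desc]
  · intro hQ
    rcases A.sheet_dichotomy_S (A.doubleTwist b₀ Q) (A.doubleTwist_codiag b₀ Q) σ hσ v₀ P with hP | hP
    · exact hP
    · have hQ' := key coprod.inr coprod.inr (A.map_inr_comp_double_ψ_hom b₀ v₀ h₀) hinrT hP
      rw [Category.assoc, coprod.braiding_hom, coprod.inr_desc] at hQ'
      exact (A.sheet_exclusive_T (A.doubleTwist b₀ Q) σ _ Q hQ' hQ).elim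

end BObj

end SemiGraphOfAnabelioids

end SemiGraphs

end Literature.AnabelianGeometry
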